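import Literature.NumberTheory.EllipticCurves.CuspFormTwistAtkinLehnerProofs
import HarnessLib

/-!
# The Atkin–Lehner involution `w_{m²}` on quadratic twists by a character of ANY modulus `m` prime to the
# cofactor — in particular `m = 4, 8` (Atkin–Lehner 1970, §6; Atkin–Li 1978, §3) — proofs

A `…Proofs` companion (theorems only: no definition, no named fact, no instance) of
`CuspFormTwistAtkinLehnerProofs`, which proves `w_{p²} f_χ = χ(−1) f_χ` for a quadratic character `χ` modulo a PRIME
`p`, `f ∈ S_k(Γ₀(N))`, `N ∣ Mp`, `p ∤ M`. The primality of the modulus is used there only through the field structure of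
`ℤ/p` (every non-zero residue is a unit). Here the same computation is run for an ARBITRARY modulus `m ≥ 1` coprime to
`M`, with `N ∣ Mm` and the twist `f_χ = g(χ⁻¹)⁻¹ ∑_{u mod m} χ⁻¹(u) f(τ + u/m) ∈ S_k(Γ₀(Mm²))` (`charTwist`, Shimura 1971
Prop. 3.64): the translates indexed by NON-units `u` carry the weight `χ(u) = 0`, and on the units the re-indexing
`u ↦ −y²u⁻¹` is an involution of `(ℤ/m)ˣ`. Result:

  **`w_{m²} f_χ = χ(−1) · f_χ`**   (`atkinLehnerInvolution_charTwist_modulus`),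

for every quadratic Dirichlet character `χ mod m` — e.g. `χ_{−4}` (`m = 4`, eigenvalue `−1`), `χ_{8}` (`m = 8`, `+1`),
`χ_{−8}` (`m = 8`, `−1`) on the twists of a form of level `N` with `N ∣ 4M`, resp. `N ∣ 8M`, `M` odd: the modular-form side
of the local root number `W₂(E ⊗ χ) = χ₂(−1)` of the twist of a curve semistable at `2` by `ℚ(√−1)`, `ℚ(√±2)` (Rohrlich 1993,
Prop. 2 (iii) for potentially multiplicative reduction; the case the tree's `localRootNumber` does not cover). Also the
`At p` form for `m = p^a` (`Q_p = m²` at level `Mm²`, `p ∤ M`) and the versions at a level `L = Mm²` given propositionally.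

## Proof

Verbatim the sibling's (module docstring of `CuspFormTwistAtkinLehnerProofs`): with `w(m²) = (m²x, y; Mm², m²)`,
`m²x − My = 1`, for a UNIT `u mod m` and `v = −y²u⁻¹`: `[1, u/m; 0, 1] · w(m²) = (m·1) · γ_u · [1, v/m; 0, 1]` with
`γ_u = (mx + UM, t + U − xV; Mm, m − MV) ∈ Γ₀(Mm)`, `U, V` representatives, `mt = y − UMV` (`My ≡ −1 (mod m)` makes
`UMV ≡ y`); so `(f ∣ [1,u/m;0,1]) ∣ w(m²) = m^{k−2} (f ∣ [1,v/m;0,1])`, and re-indexing the unit part of `∑_u χ(u)(…)` by the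
involution `u ↦ −y²u⁻¹` with `χ(−y²/v) = χ(−1)χ(v)` gives `f_χ ∣ w(m²) = m^{k−2} χ(−1) f_χ`, i.e. `w_{m²} f_χ = χ(−1) f_χ`
for Knapp's normalisation. Everything here is proved; no named facts are introduced.

## References

* A. O. L. Atkin, J. Lehner, *Hecke operators on `Γ₀(m)`*, Math. Ann. 185 (1970), §6.
* A. O. L. Atkin, W.-C. W. Li, *Twists of newforms and pseudo-eigenvalues of `W`-operators*, Invent. Math. 48 (1978), §3.
* D. Rohrlich, *Variation of the root number in families of elliptic curves*, Compositio Math. 87 (1993), Prop. 2–3.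
* A. W. Knapp, *Elliptic curves*, Princeton UP 1993, Lemma 9.24, Thm. 9.27.
-/

noncomputable section

open scoped MatrixGroups ModularForm

open CongruenceSubgroup Matrix.SpecialLinearGroup Matrix.GeneralLinearGroup UpperHalfPlane Complex

namespace Literature.NumberTheory.EllipticCurves.ModularForms

/-! ### The Atkin–Lehner matrix `w(m²)` at level `Mm²` and its commutation with the translations by units -/

section Matrices

variable {m : ℕ} [NeZero m] {M : ℕ}

/-- `(M m²) / m² = M`. [folklore] -/
private theorem mul_sq_div_sq_modulus : M * m ^ 2 / m ^ 2 = M :=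
  Nat.mul_div_cancel _ (pow_pos (Nat.pos_of_ne_zero (NeZero.ne m)) 2)

/-- `m²` and `M = (Mm²)/m²` are coprime when `gcd(m, M) = 1` (`m² ∥ Mm²`). [folklore] -/
private theorem coprime_sq_div_of_coprime (hmM : Nat.Coprime m M) : Nat.Coprime (m ^ 2) (M * m ^ 2 / m ^ 2) := by
  rw [mul_sq_div_sq_modulus]
  exact Nat.Coprime.pow_left 2 hmM

/-- The entries of `β(m²) = (x y; M m²)` at level `Mm²`: second row `(M, m²)` and the Bézout relation `m² x − M y = 1`
(Knapp 1993, (9.62)). [cite: Knapp1993, (9.62)] -/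
theorem atkinLehnerSL_sq_entries_modulus (hmM : Nat.Coprime m M) :
    (atkinLehnerSL (M * m ^ 2) (m ^ 2)) 1 0 = (M : ℤ) ∧
      (atkinLehnerSL (M * m ^ 2) (m ^ 2)) 1 1 = ((m : ℤ) ^ 2) ∧
      ((m : ℤ) ^ 2) * (atkinLehnerSL (M * m ^ 2) (m ^ 2)) 0 0 -
        (M : ℤ) * (atkinLehnerSL (M * m ^ 2) (m ^ 2)) 0 1 = 1 := by
  have hc := coprime_sq_div_of_coprime (M := M) hmM
  obtain ⟨h10, h11⟩ := atkinLehnerSL_apply_one (M * m ^ 2) (m ^ 2) hc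
  have hb := atkinLehnerSL_bezout (M * m ^ 2) (m ^ 2) hc
  rw [mul_sq_div_sq_modulus] at h10 hb
  refine ⟨h10, by rw [h11]; push_cast; ring, ?_⟩
  push_cast at hb
  exact hb

/-- `My ≡ −1 (mod m)` for the upper-right entry `y` of `β(m²)`. [folklore] -/
private theorem natCast_mul_entry_eq_neg_one_modulus (hmM : Nat.Coprime m M) :
    (M : ZMod m) * (((atkinLehnerSL (M * m ^ 2) (m ^ 2)) 0 1 : ℤ) : ZMod m) = -1 := by
  obtain ⟨-, -, hb⟩ := atkinLehnerSL_sq_entries_modulus (M := M) hmM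
  have h := congrArg (fun z : ℤ ↦ (z : ZMod m)) hb
  push_cast at h
  rw [ZMod.natCast_self, zero_pow two_ne_zero, zero_mul, zero_sub] at h
  linear_combination -h

/-- The entry `y mod m` is a unit of `ℤ/m` (`My ≡ −1`). [folklore] -/
private theorem isUnit_entry_modulus (hmM : Nat.Coprime m M) :
    IsUnit ((((atkinLehnerSL (M * m ^ 2) (m ^ 2)) 0 1 : ℤ) : ZMod m)) := by
  have h := natCast_mul_entry_eq_neg_one_modulus (M := M) hmM
  exact isUnit_iff_exists_inv.mpr ⟨-(M : ZMod m), by linear_combination -h⟩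

/-- **Commutation of `w(m²)` with the translations by UNITS** (the matrix identity behind Atkin–Lehner 1970, §6 /
Atkin–Li 1978, §3, for an arbitrary modulus): for a unit `u mod m`, with `w(m²) = (m²x, y; Mm², m²)` and `v = −y²u⁻¹ mod m`,
`[1, u/m; 0, 1] w(m²) = (m · 1) γ_u [1, v/m; 0, 1]` for an explicit `γ_u ∈ Γ₀(Mm)`, namely
`γ_u = (mx + UM, t + U − xV; Mm, m − MV)` with `U = u.val`, `V = v.val`, `mt = y − UMV`. [cite: AtkinLi1978, §3] -/
theorem exists_twistT_mul_atkinLehnerW_eq_modulus [NeZero M] (hmM : Nat.Coprime m M) {u : ZMod m} (hu : IsUnit u) :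
    ∃ γ' ∈ Gamma0 (M * m),
      twistT u * glCast (atkinLehnerW (M * m ^ 2) (m ^ 2) : GL (Fin 2) ℚ) =
        tpD m * tpG m * (mapGL ℝ γ' : GL (Fin 2) ℝ) *
          twistT (-((((atkinLehnerSL (M * m ^ 2) (m ^ 2)) 0 1 : ℤ) : ZMod m)) ^ 2 * u⁻¹) := by
  obtain ⟨h10, h11, hbez⟩ := atkinLehnerSL_sq_entries_modulus (M := M) hmM
  have hMy := natCast_mul_entry_eq_neg_one_modulus (M := M) hmM
  set β := atkinLehnerSL (M * m ^ 2) (m ^ 2) with hβ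
  set x := β 0 0 with hx
  set y := β 0 1 with hy
  set v : ZMod m := -((y : ZMod m)) ^ 2 * u⁻¹ with hv
  set U : ℤ := (u.val : ℤ) with hU
  set V : ℤ := (v.val : ℤ) with hV
  have hm0 : (m : ℝ) ≠ 0 := by exact_mod_cast NeZero.ne m
  -- `m ∣ y - U M V`
  have hdvd : (m : ℤ) ∣ y - U * M * V := by
    rw [← ZMod.intCast_zmod_eq_zero_iff_dvd]
    have hUc : ((U : ℤ) : ZMod m) = u := by simp [hU]
    have hVc : ((V : ℤ) : ZMod m) = v := by simp [hV]
    push_cast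
    rw [hUc, hVc, hv]
    have hu' : u * u⁻¹ = 1 := ZMod.mul_inv_of_unit u hu
    linear_combination (M : ZMod m) * (y : ZMod m) ^ 2 * hu' + (y : ZMod m) * hMy
  obtain ⟨t, ht⟩ := hdvd
  let A : Matrix (Fin 2) (Fin 2) ℤ := !![m * x + U * M, t + U - x * V; M * m, m - M * V]
  have hA : A.det = 1 := by
    rw [Matrix.det_fin_two_of]
    linear_combination hbez + (M : ℤ) * ht
  refine ⟨⟨A, hA⟩, ?_, ?_⟩
  · rw [Gamma0_mem]
    simp only [A, Matrix.of_apply, Matrix.cons_val', Matrix.cons_val_zero, Matrix.cons_val_one,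
      Matrix.cons_val_fin_one]
    rw [ZMod.intCast_zmod_eq_zero_iff_dvd]
    exact ⟨1, by push_cast; ring⟩
  · refine Units.ext ?_
    have hUr : ((u.val : ℕ) : ℝ) = (U : ℝ) := by rw [hU]; push_cast; rfl
    have hVr : ((v.val : ℕ) : ℝ) = (V : ℝ) := by rw [hV]; push_cast; rfl
    have h10r : ((β 1 0 : ℤ) : ℝ) = M := by exact_mod_cast h10
    have h11r : ((β 1 1 : ℤ) : ℝ) = (m : ℝ) ^ 2 := by exact_mod_cast h11
    have htr : (y : ℝ) - U * M * V = m * t := by exact_mod_cast ht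
    have hQ : (((m ^ 2 : ℕ) : ℝ)) = (m : ℝ) ^ 2 := by push_cast; ring
    have hβmap : ((β : Matrix (Fin 2) (Fin 2) ℤ).map fun z : ℤ ↦ (z : ℝ)) =
        !![(x : ℝ), (y : ℝ); (M : ℝ), (m : ℝ) ^ 2] := by
      ext i j
      fin_cases i <;> fin_cases j <;> simp [← hx, ← hy, h10r, h11r]
    have hAmap : (((⟨A, hA⟩ : SL(2, ℤ)) : Matrix (Fin 2) (Fin 2) ℤ).map fun z : ℤ ↦ (z : ℝ)) =
        !![(m : ℝ) * x + U * M, (t : ℝ) + U - x * V; (M : ℝ) * m, (m : ℝ) - M * V] := by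
      ext i j
      fin_cases i <;> fin_cases j <;> simp [A]
    rw [glCast_atkinLehnerW, ← hβ]
    simp only [Matrix.GeneralLinearGroup.coe_mul, val_twistT, val_mapGL', val_tpD, val_tpG, hβmap,
      hAmap, hUr, hVr, hQ]
    ext i j
    fin_cases i <;> fin_cases j <;> simp [Matrix.mul_apply, Fin.sum_univ_two] <;> field_simp <;>
      (first | ring1 | linear_combination htr)

end Matrices

/-! ### `f_χ ∣ w(m²) = m^{k-2} χ(-1) f_χ` -/

section Slash

variable {m : ℕ} [NeZero m] {M : ℕ} [NeZero M] {N : ℕ} [NeZero N] {k : ℤ}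

omit [NeZero m] [NeZero M] [NeZero N] in
/-- `N ∣ Mm²` from `N ∣ Mm`. [folklore] -/
private theorem dvd_mul_sq_of_dvd_mul_modulus (hN : N ∣ M * m) : N ∣ M * m ^ 2 :=
  hN.trans ⟨m, by ring⟩

omit [NeZero m] [NeZero M] in
/-- `m² ∣ Mm²`. [folklore] -/
private theorem sq_dvd_mul_sq_modulus : m ^ 2 ∣ M * m ^ 2 := Dvd.intro_left M rfl

/-- **`(∑_u χ(u) f(· + u/m)) ∣ w(m²) = m^{k−2} χ(−1) ∑_u χ(u) f(· + u/m)`** for `f ∈ S_k(Γ₀(N))`, `N ∣ Mm`, `gcd(m, M) = 1`,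
`χ` quadratic mod `m` (any modulus; Atkin–Lehner 1970, §6; Atkin–Li 1978, §3): the non-units carry the weight `χ(u) = 0`, the
units are permuted by the involution `u ↦ −y²u⁻¹`. [cite: AtkinLi1978, §3] -/
theorem coe_twistRaw_slash_atkinLehnerW_modulus (hmM : Nat.Coprime m M) (hN : N ∣ M * m) (f : CuspForm (Gamma0 N) k)
    {χ : DirichletCharacter ℂ m} (hχ : χ.IsQuadratic) :
    (⇑(twistRaw (M * m ^ 2) (dvd_mul_sq_of_dvd_mul_modulus hN) sq_dvd_mul_sq_modulus f χ) : ℍ → ℂ) ∣[k]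
        glCast (atkinLehnerW (M * m ^ 2) (m ^ 2) : GL (Fin 2) ℚ) =
      ((m : ℂ) ^ (k - 2) * χ (-1)) •
        (⇑(twistRaw (M * m ^ 2) (dvd_mul_sq_of_dvd_mul_modulus hN) sq_dvd_mul_sq_modulus f χ) : ℍ → ℂ) := by
  have hMy := natCast_mul_entry_eq_neg_one_modulus (M := M) hmM
  have hyu : IsUnit ((((atkinLehnerSL (M * m ^ 2) (m ^ 2)) 0 1 : ℤ) : ZMod m)) := isUnit_entry_modulus (M := M) hmM
  set y : ZMod m := (((atkinLehnerSL (M * m ^ 2) (m ^ 2)) 0 1 : ℤ) : ZMod m) with hy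
  -- the unit `c = −y²` and the re-indexing involution `u ↦ c u⁻¹` on units (identity on non-units)
  have hcu : IsUnit (-y ^ 2 : ZMod m) := (hyu.pow 2).neg
  obtain ⟨C, hC⟩ := hcu
  let e : ZMod m → ZMod m := fun u ↦ if IsUnit u then -y ^ 2 * u⁻¹ else u
  have he_unit : ∀ {u : ZMod m} (hu : IsUnit u), e u = -y ^ 2 * u⁻¹ := fun hu ↦ if_pos hu
  have he_coe : ∀ U : (ZMod m)ˣ, e (U : ZMod m) = ((C * U⁻¹ : (ZMod m)ˣ) : ZMod m) := by
    intro U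
    rw [he_unit U.isUnit, ZMod.inv_coe_unit, Units.val_mul, hC]
  have he : Function.Involutive e := by
    intro u
    by_cases hu : IsUnit u
    · obtain ⟨U, rfl⟩ := hu
      rw [he_coe U, he_coe (C * U⁻¹)]
      congr 1
      rw [mul_inv_rev, inv_inv, ← mul_assoc, mul_comm C U, mul_assoc, mul_inv_cancel, mul_one]
    · simp only [e, if_neg hu]
  -- the pointwise identity
  have hσW : ∀ z, σ (glCast (atkinLehnerW (M * m ^ 2) (m ^ 2) : GL (Fin 2) ℚ)) z = z := σ_glCast _
  have key : ∀ u : ZMod m, (χ u • ((⇑f : ℍ → ℂ) ∣[k] twistT u)) ∣[k]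
      glCast (atkinLehnerW (M * m ^ 2) (m ^ 2) : GL (Fin 2) ℚ) =
      (χ u * (m : ℂ) ^ (k - 2)) • ((⇑f : ℍ → ℂ) ∣[k] twistT (e u)) := by
    intro u
    by_cases hu : IsUnit u
    · obtain ⟨γ', hγ', hmat⟩ := exists_twistT_mul_atkinLehnerW_eq_modulus hmM hu
      have hmem : (mapGL ℝ γ' : GL (Fin 2) ℝ) ∈
          ((Gamma0 N : Subgroup SL(2, ℤ)) : Subgroup (GL (Fin 2) ℝ)) :=
        ⟨γ', mem_Gamma0_of_entry_eq hN hγ' rfl, rfl⟩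
      rw [he_unit hu, ModularForm.smul_slash, hσW, ← SlashAction.slash_mul, hmat, SlashAction.slash_mul,
        SlashAction.slash_mul, slash_tpD_mul_tpG, ModularForm.smul_slash, σ_mapGL,
        SlashInvariantFormClass.slash_action_eq f _ hmem, ModularForm.smul_slash, σ_twistT,
        smul_smul]
    · rw [MulChar.map_nonunit χ hu, zero_mul, zero_smul, zero_smul, SlashAction.zero_slash]
  rw [coe_twistRaw, hχ.inv, finset_sum_slash]
  simp_rw [key]
  -- re-index by the involution `e`
  have hre : ∑ u : ZMod m, (χ u * (m : ℂ) ^ (k - 2)) • ((⇑f : ℍ → ℂ) ∣[k] twistT (e u)) =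
      ∑ w : ZMod m, (χ (e w) * (m : ℂ) ^ (k - 2)) • ((⇑f : ℍ → ℂ) ∣[k] twistT w) := by
    rw [← Equiv.sum_comp (he.toPerm e) (fun w : ZMod m ↦
      (χ (e w) * (m : ℂ) ^ (k - 2)) • ((⇑f : ℍ → ℂ) ∣[k] twistT w))]
    refine Finset.sum_congr rfl fun u _ ↦ ?_
    simp only [Function.Involutive.coe_toPerm, he u]
  rw [hre, Finset.smul_sum]
  refine Finset.sum_congr rfl fun w _ ↦ ?_
  have hχe : χ (e w) = χ (-1) * χ w := by
    by_cases hw : IsUnit w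
    · obtain ⟨W, rfl⟩ := hw
      have hsq : χ y ^ 2 = 1 := apply_sq_eq_one_of_isQuadratic hχ hyu
      have hWsq : χ (W : ZMod m) ^ 2 = 1 := apply_sq_eq_one_of_isQuadratic hχ W.isUnit
      have hinv : χ ((W⁻¹ : (ZMod m)ˣ) : ZMod m) = χ (W : ZMod m) := by
        have h1 : χ ((W⁻¹ : (ZMod m)ˣ) : ZMod m) * χ (W : ZMod m) = 1 := by
          rw [← map_mul, ← Units.val_mul, inv_mul_cancel, Units.val_one, map_one]
        linear_combination (-χ ((W⁻¹ : (ZMod m)ˣ) : ZMod m)) * hWsq + (χ (W : ZMod m)) * h1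
      rw [he_coe W, Units.val_mul, map_mul, hC, hinv, neg_eq_neg_one_mul, map_mul, map_pow, hsq, mul_one]
    · simp only [e, if_neg hw, MulChar.map_nonunit χ hw, mul_zero]
  rw [hχe, smul_smul]
  congr 1
  ring

/-- The normalisation constant of `w_{m²}` cancels the scalar slash factor: `(m²)^{1−k/2} · m^{k−2} = 1`. [folklore] -/
private theorem rpow_sq_mul_zpow_eq_one_modulus (k : ℤ) :
    ((((m ^ 2 : ℕ) : ℝ) ^ (1 - (k : ℝ) / 2) : ℝ) : ℂ) * (m : ℂ) ^ (k - 2) = 1 := by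
  have hm0 : (0 : ℝ) ≤ m := Nat.cast_nonneg m
  have h1 : (((m ^ 2 : ℕ) : ℝ) ^ (1 - (k : ℝ) / 2) : ℝ) = (m : ℝ) ^ ((2 - k : ℤ)) := by
    rw [Nat.cast_pow, ← Real.rpow_natCast (m : ℝ) 2, ← Real.rpow_mul hm0, ← Real.rpow_intCast]
    congr 1
    push_cast
    ring
  rw [h1]
  push_cast
  rw [← zpow_add₀ (by exact_mod_cast (NeZero.ne m) : (m : ℂ) ≠ 0)]
  norm_num

/-- **`w_{m²} f_χ = χ(−1) f_χ` for a quadratic character modulo ANY `m` prime to `M`**: the twist of `f ∈ S_k(Γ₀(N))`,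
`N ∣ Mm`, by a quadratic `χ mod m` is an eigenvector of the Atkin–Lehner involution `w_{m²}` of `S_k(Γ₀(Mm²))` (Knapp's
normalisation, `atkinLehnerInvolution`) with eigenvalue `χ(−1)` (Atkin–Lehner 1970, §6; Atkin–Li 1978, §3). E.g. `m = 4, 8`:
`w_{16} f_{χ_{−4}} = −f_{χ_{−4}}`, `w_{64} f_{χ_{8}} = f_{χ_8}`, `w_{64} f_{χ_{−8}} = −f_{χ_{−8}}` for `f` of level `N ∣ 4M`, `8M`, `M` odd.
[cite: AtkinLi1978, §3] -/
theorem atkinLehnerInvolution_charTwist_modulus (hmM : Nat.Coprime m M) (hN : N ∣ M * m)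
    {χ : DirichletCharacter ℂ m} (hχ : χ.IsQuadratic) (f : CuspForm (Gamma0 N) k) :
    atkinLehnerInvolution (M * m ^ 2) k (m ^ 2)
        (charTwist (M * m ^ 2) (dvd_mul_sq_of_dvd_mul_modulus hN) sq_dvd_mul_sq_modulus hχ f) =
      χ (-1) • charTwist (M * m ^ 2) (dvd_mul_sq_of_dvd_mul_modulus hN) sq_dvd_mul_sq_modulus hχ f := by
  apply DFunLike.coe_injective
  rw [atkinLehnerInvolution_apply_eq_slash (M * m ^ 2) k (m ^ 2) sq_dvd_mul_sq_modulus
      (coprime_sq_div_of_coprime hmM), coe_charTwist, ModularForm.smul_slash, σ_glCast,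
    coe_twistRaw_slash_atkinLehnerW_modulus hmM hN f hχ, CuspForm.IsGLPos.coe_smul, coe_charTwist, smul_smul,
    smul_smul, smul_smul]
  congr 1
  linear_combination ((gaussSum χ⁻¹ (ZMod.stdAddChar (N := m)))⁻¹ * χ (-1)) *
    rpow_sq_mul_zpow_eq_one_modulus (m := m) k

/-! ### The `At p` form for a prime-power modulus `m = p^a` -/

/-- `p^{v_p(M p^{2a})} = (p^a)²` for `p ∤ M`, `a ≥ 1`: at level `M m²`, `m = p^a`, the exact `p`-power is `Q_p = m²`. [folklore] -/
private theorem pow_factorization_mul_sq_primePow {p a : ℕ} (hp : p.Prime) (hpM : ¬ p ∣ M) (hm : m = p ^ a) :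
    p ^ (M * m ^ 2).factorization p = m ^ 2 := by
  subst hm
  rw [Nat.factorization_mul (NeZero.ne M) (pow_ne_zero 2 (NeZero.ne _)), Finsupp.add_apply,
    Nat.factorization_eq_zero_of_not_dvd hpM, zero_add, ← pow_mul, Nat.factorization_pow, Finsupp.smul_apply,
    hp.factorization, Finsupp.single_eq_same, smul_eq_mul, mul_one, pow_mul]

/-- **`w_{Q_p} f_χ = χ(−1) f_χ` at level `M p^{2a}`** for a quadratic character `χ mod p^a` (`p ∤ M`, `N ∣ M p^a`): the `At p` form of
`atkinLehnerInvolution_charTwist_modulus` (`Q_p = p^{2a}`). [cite: AtkinLi1978, §3] -/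
theorem atkinLehnerInvolutionAt_charTwist_primePow {p a : ℕ} (hp : p.Prime) (hpM : ¬ p ∣ M) (hm : m = p ^ a)
    (ha : 0 < a) (hN : N ∣ M * m) {χ : DirichletCharacter ℂ m} (hχ : χ.IsQuadratic) (f : CuspForm (Gamma0 N) k) :
    atkinLehnerInvolutionAt (M * m ^ 2) k p
        (charTwist (M * m ^ 2) (dvd_mul_sq_of_dvd_mul_modulus hN) sq_dvd_mul_sq_modulus hχ f) =
      χ (-1) • charTwist (M * m ^ 2) (dvd_mul_sq_of_dvd_mul_modulus hN) sq_dvd_mul_sq_modulus hχ f := by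
  have hmM : Nat.Coprime m M := by
    rw [hm]; exact Nat.Coprime.pow_left a ((Nat.Prime.coprime_iff_not_dvd hp).mpr hpM)
  rw [atkinLehnerInvolutionAt_eq (pow_factorization_mul_sq_primePow (M := M) hp hpM hm)]
  have _ := ha
  exact atkinLehnerInvolution_charTwist_modulus hmM hN hχ f

/-- **The Atkin–Lehner eigenvalue at `p` of a non-zero quadratic twist by `χ mod p^a` is `χ(−1)`** (`p ∤ M`, `N ∣ M p^a`).
[cite: AtkinLi1978, §3] -/
theorem atkinLehnerEigenvalueAt_charTwist_primePow {p a : ℕ} (hp : p.Prime) (hpM : ¬ p ∣ M) (hm : m = p ^ a)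
    (ha : 0 < a) (hN : N ∣ M * m) {χ : DirichletCharacter ℂ m} (hχ : χ.IsQuadratic) {f : CuspForm (Gamma0 N) k}
    (hf : charTwist (M * m ^ 2) (dvd_mul_sq_of_dvd_mul_modulus hN) sq_dvd_mul_sq_modulus hχ f ≠ 0) :
    atkinLehnerEigenvalueAt (charTwist (M * m ^ 2) (dvd_mul_sq_of_dvd_mul_modulus hN) sq_dvd_mul_sq_modulus hχ f) p =
      χ (-1) :=
  atkinLehnerEigenvalueAt_eq_of_eq_smul hf (atkinLehnerInvolutionAt_charTwist_primePow hp hpM hm ha hN hχ f)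

end Slash

/-! ### The same statements at a level `L = Mm²` given propositionally -/

section Level

variable {m : ℕ} [NeZero m] {M : ℕ} [NeZero M] {N : ℕ} [NeZero N] {k : ℤ} {L : ℕ} [NeZero L]

/-- `w_{m²} f_χ = χ(−1) f_χ` at a level `L = Mm²` (`atkinLehnerInvolution_charTwist_modulus` transported along `hL`).
[cite: AtkinLi1978, §3] -/
theorem atkinLehnerInvolution_charTwist_modulus_of_eq (hL : L = M * m ^ 2) (hmM : Nat.Coprime m M)
    (hN : N ∣ M * m) (hNL : N ∣ L) (hmL : m ^ 2 ∣ L) {χ : DirichletCharacter ℂ m}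
    (hχ : χ.IsQuadratic) (f : CuspForm (Gamma0 N) k) :
    atkinLehnerInvolution L k (m ^ 2) (charTwist L hNL hmL hχ f) = χ (-1) • charTwist L hNL hmL hχ f := by
  subst hL
  exact atkinLehnerInvolution_charTwist_modulus hmM hN hχ f

/-- `w_{Q_p} f_χ = χ(−1) f_χ` at a level `L = M p^{2a}` for `χ mod p^a` (`p ∤ M`, `N ∣ M p^a`). [cite: AtkinLi1978, §3] -/
theorem atkinLehnerInvolutionAt_charTwist_primePow_of_eq {p a : ℕ} (hp : p.Prime) (hpM : ¬ p ∣ M) (hm : m = p ^ a)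
    (ha : 0 < a) (hL : L = M * m ^ 2) (hN : N ∣ M * m) (hNL : N ∣ L) (hmL : m ^ 2 ∣ L)
    {χ : DirichletCharacter ℂ m} (hχ : χ.IsQuadratic) (f : CuspForm (Gamma0 N) k) :
    atkinLehnerInvolutionAt L k p (charTwist L hNL hmL hχ f) = χ (-1) • charTwist L hNL hmL hχ f := by
  subst hL
  exact atkinLehnerInvolutionAt_charTwist_primePow hp hpM hm ha hN hχ f

/-- `λ_p(f_χ) = χ(−1)` at a level `L = M p^{2a}` for `χ mod p^a`, `f_χ ≠ 0`. [cite: AtkinLi1978, §3] -/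
theorem atkinLehnerEigenvalueAt_charTwist_primePow_of_eq {p a : ℕ} (hp : p.Prime) (hpM : ¬ p ∣ M) (hm : m = p ^ a)
    (ha : 0 < a) (hL : L = M * m ^ 2) (hN : N ∣ M * m) (hNL : N ∣ L) (hmL : m ^ 2 ∣ L)
    {χ : DirichletCharacter ℂ m} (hχ : χ.IsQuadratic) {f : CuspForm (Gamma0 N) k}
    (hf : charTwist L hNL hmL hχ f ≠ 0) :
    atkinLehnerEigenvalueAt (charTwist L hNL hmL hχ f) p = χ (-1) :=
  atkinLehnerEigenvalueAt_eq_of_eq_smul hf (atkinLehnerInvolutionAt_charTwist_primePow_of_eq hp hpM hm ha hL hN hNL hmL hχ f)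

end Level

end Literature.NumberTheory.EllipticCurves.ModularForms

end
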